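import Summits.Ventures.PercRepro.RankLevelSetLevelEightArithCubeA
import Summits.Ventures.PercRepro.RankLevelSetLevelEightArithCubeB
import Summits.Ventures.PercRepro.RankLevelSetLevelEightArithCubeC
import Summits.Ventures.PercRepro.RankLevelSetLevelEightArithCubeD
import Summits.Ventures.PercRepro.RankLevelSetLevelEightArithCubeE
import Summits.Ventures.PercRepro.RankLevelSetLevelEightArithCubeF
import Summits.Ventures.PercRepro.RankLevelSetLevelEightArithCubeG
import Summits.Ventures.PercRepro.RankLevelSetLevelEightArithCubeH
import Summits.Ventures.PercRepro.RankLevelSetLevelEightArithCubeI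
import Summits.Ventures.PercRepro.RankLevelSetLevelEightArithCubeJ
import Summits.Ventures.PercRepro.RankLevelSetLevelEightArithCubeK
import Summits.Ventures.PercRepro.RankLevelSetLevelEightArithCubeL
import Summits.Ventures.PercRepro.RankLevelSetLevelEightArithCubeM
import Summits.Ventures.PercRepro.RankLevelSetLevelEightArithCubeN
import Summits.Ventures.PercRepro.RankLevelSetLevelEightArithCubeO

/-!
# PercRepro — THE LEVEL-`8` DISPATCHER OF THE PARTITION CHAIN WITH THE CUBIC MULTIPLICITY: `(P_d)` for `9 ≤ d ≤ 168`, `p ≥ 191`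
(p4, gen 16; a feeder for S4). The 160 cases of RankLevelSetLevelEightArithCubeA … P in one statement generic in `d`.
Axioms: standard.
-/

namespace PercRepro

namespace ThmN

/-- **`(P_d)` at level `8` in the `7/8` form with the cubic multiplicity (partition count), every corank `9 ≤ d ≤ 168`,
every `p ≥ 191`, in `ℚ`** — the dispatcher of the 160 cases. -/
theorem level_eight_poly_cube (d : ℕ) (hd1 : 9 ≤ d) (hd2 : d ≤ 168) (p : ℕ) (hp : 191 ≤ p) :
    8 * ((((p + d).choose 8 : ℕ) : ℚ) + (∑ j ∈ Finset.range (d - 8), ((Nat.choose (min 150 (max ((d + min 72 d) / 2 + 1) (min 71 (d - 1) + 2) - 2)) j : ℕ) : ℚ) / (((j + 1) + 3 * (j + 1).choose 2 + 3 * (j + 1).choose 3 : ℕ) : ℚ)) *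
      (((d * (d + 1) / 2 : ℕ) : ℚ) * ((p + d).choose 6 : ℚ) + ((d * (d + 1) * (d + 2) / 3 : ℕ) : ℚ) * ((p + d).choose 5 : ℚ) + (((d + 4).choose 5 : ℕ) : ℚ) * ((p + d).choose 4 : ℚ) + (((d + 5).choose 6 : ℕ) : ℚ) * ((p + d).choose 3 : ℚ) + (((d + 6).choose 7 : ℕ) : ℚ) * ((p + d).choose 2 : ℚ) + (((d + 7).choose 8 : ℕ) : ℚ) * (p + d : ℚ) + (((d + 8).choose 9 : ℕ) : ℚ)) +
      ((∑ j ∈ Finset.range (d - 8), ((Nat.choose (min 159 (8 + d) - 9) j : ℕ) : ℚ) / (((j + 1) + 3 * (j + 1).choose 2 + 3 * (j + 1).choose 3 : ℕ) : ℚ)) - (∑ j ∈ Finset.range (d - 8), ((Nat.choose (min 71 (d - 1)) j : ℕ) : ℚ) / (((j + 1) + 3 * (j + 1).choose 2 + 3 * (j + 1).choose 3 : ℕ) : ℚ))) *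
      ((d * (d + 1) / 2 * (min 159 (8 + d)).choose 6 + d * (d + 1) * (d + 2) / 3 * (min 159 (8 + d)).choose 5 + (d + 4).choose 5 * (min 159 (8 + d)).choose 4 + (d + 5).choose 6 * (min 159 (8 + d)).choose 3 + (d + 6).choose 7 * (min 159 (8 + d)).choose 2 + (d + 7).choose 8 * (min 159 (8 + d)) + (d + 8).choose 9 : ℕ) : ℚ)) ≤
      7 * 2 ^ (d - 8) * (((p + 8).choose 8 : ℕ) : ℚ) := by
  interval_cases d
  · exact level_eight_poly_cube_9 p hp
  · exact level_eight_poly_cube_10 p hp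
  · exact level_eight_poly_cube_11 p hp
  · exact level_eight_poly_cube_12 p hp
  · exact level_eight_poly_cube_13 p hp
  · exact level_eight_poly_cube_14 p hp
  · exact level_eight_poly_cube_15 p hp
  · exact level_eight_poly_cube_16 p hp
  · exact level_eight_poly_cube_17 p hp
  · exact level_eight_poly_cube_18 p hp
  · exact level_eight_poly_cube_19 p hp
  · exact level_eight_poly_cube_20 p hp
  · exact level_eight_poly_cube_21 p hp
  · exact level_eight_poly_cube_22 p hp
  · exact level_eight_poly_cube_23 p hp
  · exact level_eight_poly_cube_24 p hp
  · exact level_eight_poly_cube_25 p hp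
  · exact level_eight_poly_cube_26 p hp
  · exact level_eight_poly_cube_27 p hp
  · exact level_eight_poly_cube_28 p hp
  · exact level_eight_poly_cube_29 p hp
  · exact level_eight_poly_cube_30 p hp
  · exact level_eight_poly_cube_31 p hp
  · exact level_eight_poly_cube_32 p hp
  · exact level_eight_poly_cube_33 p hp
  · exact level_eight_poly_cube_34 p hp
  · exact level_eight_poly_cube_35 p hp
  · exact level_eight_poly_cube_36 p hp
  · exact level_eight_poly_cube_37 p hp
  · exact level_eight_poly_cube_38 p hp
  · exact level_eight_poly_cube_39 p hp
  · exact level_eight_poly_cube_40 p hp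
  · exact level_eight_poly_cube_41 p hp
  · exact level_eight_poly_cube_42 p hp
  · exact level_eight_poly_cube_43 p hp
  · exact level_eight_poly_cube_44 p hp
  · exact level_eight_poly_cube_45 p hp
  · exact level_eight_poly_cube_46 p hp
  · exact level_eight_poly_cube_47 p hp
  · exact level_eight_poly_cube_48 p hp
  · exact level_eight_poly_cube_49 p hp
  · exact level_eight_poly_cube_50 p hp
  · exact level_eight_poly_cube_51 p hp
  · exact level_eight_poly_cube_52 p hp
  · exact level_eight_poly_cube_53 p hp
  · exact level_eight_poly_cube_54 p hp
  · exact level_eight_poly_cube_55 p hp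
  · exact level_eight_poly_cube_56 p hp
  · exact level_eight_poly_cube_57 p hp
  · exact level_eight_poly_cube_58 p hp
  · exact level_eight_poly_cube_59 p hp
  · exact level_eight_poly_cube_60 p hp
  · exact level_eight_poly_cube_61 p hp
  · exact level_eight_poly_cube_62 p hp
  · exact level_eight_poly_cube_63 p hp
  · exact level_eight_poly_cube_64 p hp
  · exact level_eight_poly_cube_65 p hp
  · exact level_eight_poly_cube_66 p hp
  · exact level_eight_poly_cube_67 p hp
  · exact level_eight_poly_cube_68 p hp
  · exact level_eight_poly_cube_69 p hp
  · exact level_eight_poly_cube_70 p hp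
  · exact level_eight_poly_cube_71 p hp
  · exact level_eight_poly_cube_72 p hp
  · exact level_eight_poly_cube_73 p hp
  · exact level_eight_poly_cube_74 p hp
  · exact level_eight_poly_cube_75 p hp
  · exact level_eight_poly_cube_76 p hp
  · exact level_eight_poly_cube_77 p hp
  · exact level_eight_poly_cube_78 p hp
  · exact level_eight_poly_cube_79 p hp
  · exact level_eight_poly_cube_80 p hp
  · exact level_eight_poly_cube_81 p hp
  · exact level_eight_poly_cube_82 p hp
  · exact level_eight_poly_cube_83 p hp
  · exact level_eight_poly_cube_84 p hp
  · exact level_eight_poly_cube_85 p hp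
  · exact level_eight_poly_cube_86 p hp
  · exact level_eight_poly_cube_87 p hp
  · exact level_eight_poly_cube_88 p hp
  · exact level_eight_poly_cube_89 p hp
  · exact level_eight_poly_cube_90 p hp
  · exact level_eight_poly_cube_91 p hp
  · exact level_eight_poly_cube_92 p hp
  · exact level_eight_poly_cube_93 p hp
  · exact level_eight_poly_cube_94 p hp
  · exact level_eight_poly_cube_95 p hp
  · exact level_eight_poly_cube_96 p hp
  · exact level_eight_poly_cube_97 p hp
  · exact level_eight_poly_cube_98 p hp
  · exact level_eight_poly_cube_99 p hp
  · exact level_eight_poly_cube_100 p hp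
  · exact level_eight_poly_cube_101 p hp
  · exact level_eight_poly_cube_102 p hp
  · exact level_eight_poly_cube_103 p hp
  · exact level_eight_poly_cube_104 p hp
  · exact level_eight_poly_cube_105 p hp
  · exact level_eight_poly_cube_106 p hp
  · exact level_eight_poly_cube_107 p hp
  · exact level_eight_poly_cube_108 p hp
  · exact level_eight_poly_cube_109 p hp
  · exact level_eight_poly_cube_110 p hp
  · exact level_eight_poly_cube_111 p hp
  · exact level_eight_poly_cube_112 p hp
  · exact level_eight_poly_cube_113 p hp
  · exact level_eight_poly_cube_114 p hp
  · exact level_eight_poly_cube_115 p hp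
  · exact level_eight_poly_cube_116 p hp
  · exact level_eight_poly_cube_117 p hp
  · exact level_eight_poly_cube_118 p hp
  · exact level_eight_poly_cube_119 p hp
  · exact level_eight_poly_cube_120 p hp
  · exact level_eight_poly_cube_121 p hp
  · exact level_eight_poly_cube_122 p hp
  · exact level_eight_poly_cube_123 p hp
  · exact level_eight_poly_cube_124 p hp
  · exact level_eight_poly_cube_125 p hp
  · exact level_eight_poly_cube_126 p hp
  · exact level_eight_poly_cube_127 p hp
  · exact level_eight_poly_cube_128 p hp
  · exact level_eight_poly_cube_129 p hp
  · exact level_eight_poly_cube_130 p hp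
  · exact level_eight_poly_cube_131 p hp
  · exact level_eight_poly_cube_132 p hp
  · exact level_eight_poly_cube_133 p hp
  · exact level_eight_poly_cube_134 p hp
  · exact level_eight_poly_cube_135 p hp
  · exact level_eight_poly_cube_136 p hp
  · exact level_eight_poly_cube_137 p hp
  · exact level_eight_poly_cube_138 p hp
  · exact level_eight_poly_cube_139 p hp
  · exact level_eight_poly_cube_140 p hp
  · exact level_eight_poly_cube_141 p hp
  · exact level_eight_poly_cube_142 p hp
  · exact level_eight_poly_cube_143 p hp
  · exact level_eight_poly_cube_144 p hp
  · exact level_eight_poly_cube_145 p hp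
  · exact level_eight_poly_cube_146 p hp
  · exact level_eight_poly_cube_147 p hp
  · exact level_eight_poly_cube_148 p hp
  · exact level_eight_poly_cube_149 p hp
  · exact level_eight_poly_cube_150 p hp
  · exact level_eight_poly_cube_151 p hp
  · exact level_eight_poly_cube_152 p hp
  · exact level_eight_poly_cube_153 p hp
  · exact level_eight_poly_cube_154 p hp
  · exact level_eight_poly_cube_155 p hp
  · exact level_eight_poly_cube_156 p hp
  · exact level_eight_poly_cube_157 p hp
  · exact level_eight_poly_cube_158 p hp
  · exact level_eight_poly_cube_159 p hp
  · exact level_eight_poly_cube_160 p hp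
  · exact level_eight_poly_cube_161 p hp
  · exact level_eight_poly_cube_162 p hp
  · exact level_eight_poly_cube_163 p hp
  · exact level_eight_poly_cube_164 p hp
  · exact level_eight_poly_cube_165 p hp
  · exact level_eight_poly_cube_166 p hp
  · exact level_eight_poly_cube_167 p hp
  · exact level_eight_poly_cube_168 p hp

end ThmN

end PercRepro
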